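import Summits.QuantumFields.YangMills.Theorems.UnitScaleTiltCurvGradFlatAbel
import HarnessLib

/-!
# Flat-lattice input of the curvature-gradient bound, file 3/3: the interior LOG-LIPSCHITZ estimate for the divergence-form lattice
# Poisson equation `−Δu = Σ_k (g_k(· + v_k) − g_k)` on `ℤ^d` (`d ≥ 3`) — the discrete Calderón–Zygmund endpoint

Helper file (`--supports stmt-QuantumFields-19200`, crux child «MinimiserStabilityRegPr» of rung R3's K1, cell `ym3-torus`, seat
`ym3-torus-p1` gen 13; memo HOME/UV3-NODE.md §22).  Theorems only; no new definition.

THE ESTIMATE (`divForm_sub_le`).  There is `C = C(d)` such that for `R ≥ 4`, every `u : ℤ^d → ℝ`, unit steps `v_k = ±e_{i_k}` and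
data `g_k` with, on the sup-box of radius `4R`: `|u| ≤ M₀`, `|g_k| ≤ M` and `−Δu = Σ_{k<m} (g_k(· + v_k) − g_k)`, for every direction `j`
  `|u(e_j) − u(0)| , |u(−e_j) − u(0)| ≤ C·(1 + log R)·(m·M + M₀/R)`.
One derivative more than the `L^∞` data of a first-order (div–curl) system costs exactly the logarithm `Σ_{1≤‖y‖≤R} ‖y‖^{−d}`; `M₀/R`
is the free (harmonic) part.  Proof = the tree's cut-off/Green machinery for harmonic functions (`WeakCouplingRatesHarmonicInterior*`:
ramp cut-off `χ = cutoff R`, `poisson_repr` of `χu`, product rule `latticeLaplacianZd_mul`) with the inhomogeneity kept: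
`−Δ(χu) = χ·Σ_k(g_k(·+v_k) − g_k) + T`; the data terms are Abel-summed (file 2/3 `abel_sum_le`) and `T` is the harmonic-case kernel
(file 2/3 `sum_gHalf_mul_cutoffTerm_eq`, `kernel_diff_sum_le`).

* `divForm_sub_le_at` (explicit constants at a base point), **`divForm_sub_le`**, and `divForm_sub_le'` (the equation read as
  `Σᵢ((u z − u(z+eᵢ)) + (u z − u(z−eᵢ)))`, the componentwise form of the tree's `LatticeChain.negLap₂`).

References: G. F. Lawler, V. Limic, *Random Walk: A Modern Introduction* (2010) Thm. 4.3.1, Thm. 6.3.8; the endpoint estimate is the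
lattice form of the `L^∞ → log-Lipschitz` mapping of `∇²Δ⁻¹`.  No sorry, standard axioms.  NOT a claim about the mass gap.
-/


set_option autoImplicit false

noncomputable section

open Finset
open Literature.Probability.LatticeModels
open Literature.MathematicalPhysics.QuantumFieldTheory.LatticeForm (e)
open Summit.QuantumFields.YangMills.Theorems.WeakCouplingRates
  (abs_coord_le_norm norm_le_sqrt_sum_sq one_le_norm_of_ne_zero norm_e)
open Summit.QuantumFields.YangMills.Theorems.WeakCouplingRates.HarmonicInterior

namespace Summit.QuantumFields.YangMills.Theorems.CurvGradFlat

variable {d : ℕ}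

/-! ## §3 The interior log-Lipschitz estimate -/

/-- Sites of `sbox (2R+1)` and their unit neighbours lie in the hypothesis box of radius `4R` (`R ≥ 1`). [folklore] -/
theorem forall_abs_le_of_mem_sbox {R : ℕ} (hR : 1 ≤ R) {z : Site d} (hz : z ∈ sbox (d := d) (2 * R + 1)) (w : Site d)
    (hw : ∀ k, |w k| ≤ 1) (k : Fin d) : |(z + w) k| ≤ 4 * (R : ℤ) := by
  have h1 := mem_sbox.1 hz k
  have h2 := hw k
  rw [Pi.add_apply]
  have := abs_add_le (z k) (w k)
  push_cast at h1
  omega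

/-- **THE ESTIMATE AT A BASE POINT** (explicit constants): for `R ≥ 4`, `|x_k| ≤ 1` and `|(x + e_j)_k| ≤ 1`, data as in
`divForm_sub_le`: `|u(x + e_j) − u(x)| ≤ m·M·A_R + M₀·D/R`. [folklore] -/
theorem divForm_sub_le_at (hd : 3 ≤ d) {Kg Kh : ℝ} (hKg : 0 ≤ Kg) (hKh : 0 ≤ Kh)
    (hg : ∀ (w : Site d) (i : Fin d), |gHalf (w + e i) - gHalf w| ≤ Kg / (max 1 ‖w‖) ^ (d - 1) ∧
      |gHalf (w - e i) - gHalf w| ≤ Kg / (max 1 ‖w‖) ^ (d - 1))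
    (hh : ∀ (w : Site d) (i j : Fin d), |gHalf (w + e j + e i) - gHalf (w + e j) - gHalf (w + e i) + gHalf w| ≤ Kh / (max 1 ‖w‖) ^ d)
    {R : ℕ} (hR : 4 ≤ R) {m : ℕ} (u : Site d → ℝ) (g : Fin m → Site d → ℝ) (v : Fin m → Site d) {M₀ M : ℝ}
    (hv : ∀ k, ∃ i, v k = e i ∨ v k = -e i)
    (hu : ∀ z : Site d, (∀ k, |z k| ≤ 4 * (R : ℤ)) → |u z| ≤ M₀)
    (hgM : ∀ z : Site d, (∀ k, |z k| ≤ 4 * (R : ℤ)) → ∀ k, |g k z| ≤ M)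
    (heq : ∀ z : Site d, (∀ k, |z k| ≤ 4 * (R : ℤ)) → -latticeLaplacianZd u z = ∑ k, (g k (z + v k) - g k z))
    (x : Site d) (j : Fin d) (hx : ∀ k, |x k| ≤ 1) (hxj : ∀ k, |(x + e j) k| ≤ 1) :
    |u (x + e j) - u x| ≤
      m * M * (Kh * 3 ^ d * (3 ^ d * ((1 + 2 * d * 3 ^ (d - 1)) * (2 + Real.log (2 * R + 1 : ℕ)))) + Kg * 2 ^ (d - 1) * 5 ^ d) +
        M₀ * (d * (4 * Kg * 2 ^ d * 7 ^ (d - 1) + 2 * Kh * 28 ^ d)) / R := by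
  have hR0 : 0 < R := by omega
  have hR1 : 1 ≤ R := by omega
  have hxn : ‖x‖ ≤ 1 := (pi_norm_le_iff_of_nonneg zero_le_one).2 fun k => by
    rw [Int.norm_eq_abs]; exact_mod_cast hx k
  -- the cut-off product
  set w : Site d → ℝ := fun z => cutoff R z * u z with hw
  have hzero : ∀ (z : Site d) (k : Fin d), 2 * (R : ℤ) ≤ |z k| → w z = 0 := fun z k hz => by
    simp only [hw]; rw [cutoff_eq_zero (k := k) hz, zero_mul]
  have hw0 : ∀ z ∉ sbox (d := d) (2 * R + 1), w z = 0 := by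
    intro z hz
    obtain ⟨k, hk⟩ := not_mem_sbox.1 hz
    push_cast at hk
    exact hzero z k (by omega)
  have hΔw0 : ∀ z ∉ sbox (d := d) (2 * R + 1), latticeLaplacianZd w z = 0 := by
    intro z hz
    obtain ⟨k, hk⟩ := not_mem_sbox.1 hz
    push_cast at hk
    have hk' := lt_abs.1 hk
    have hk1 : ∀ i : Fin d, w (z + e i) = 0 ∧ w (z - e i) = 0 := by
      intro i
      by_cases hki : k = i
      · subst hki
        exact ⟨hzero _ k (by rw [add_e_apply_same]; exact le_abs.2 (by omega)),
          hzero _ k (by rw [sub_e_apply_same]; exact le_abs.2 (by omega))⟩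
      · exact ⟨hzero _ k (by rw [add_e_apply_ne z hki]; omega), hzero _ k (by rw [sub_e_apply_ne z hki]; omega)⟩
    simp only [latticeLaplacianZd, ← e_def]
    rw [Finset.sum_eq_zero fun i _ => by rw [(hk1 i).1, (hk1 i).2, add_zero], hzero z k (by omega)]
    ring
  -- `−Δw = χ·S + T`
  have hΔw : ∀ y, -latticeLaplacianZd w y = cutoff R y * ∑ k, (g k (y + v k) - g k y) +
      ∑ i, (dminus R i y * u (y - e i) - dplus R i y * u (y + e i)) := by
    intro y
    simp only [hw]
    rw [latticeLaplacianZd_mul]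
    have h0 : -(cutoff R y * latticeLaplacianZd u y) = cutoff R y * ∑ k, (g k (y + v k) - g k y) := by
      by_cases hc : cutoff R y = 0
      · rw [hc, zero_mul, zero_mul, neg_zero]
      · have hy := forall_abs_lt_of_cutoff_ne_zero hc
        rw [← heq y fun k => by have := hy k; omega]; ring
    rw [neg_add, h0, ← Finset.sum_neg_distrib]
    congr 1
    refine Finset.sum_congr rfl fun i _ => ?_
    simp only [dminus, dplus]; ring
  -- Poisson representation at the two points, `χ = 1` there
  have hP := fun p => poisson_repr hd hw0 hΔw0 p
  have hwx : w x = u x := by simp only [hw]; rw [cutoff_eq_one hR0 (fun k => by have := hx k; omega), one_mul]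
  have hwxj : w (x + e j) = u (x + e j) := by
    simp only [hw]; rw [cutoff_eq_one hR0 (fun k => by have := hxj k; omega), one_mul]
  rw [← hwx, ← hwxj, hP x, hP (x + e j), ← Finset.sum_sub_distrib]
  have hsplit : ∀ y ∈ sbox (d := d) (2 * R + 1),
      gHalf (x + e j - y) * -latticeLaplacianZd w y - gHalf (x - y) * -latticeLaplacianZd w y =
      ∑ k, (gHalf (x + e j - y) - gHalf (x - y)) * (cutoff R y * (g k (y + v k) - g k y)) +
        (gHalf (x + e j - y) * ∑ i, (dminus R i y * u (y - e i) - dplus R i y * u (y + e i)) -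
          gHalf (x - y) * ∑ i, (dminus R i y * u (y - e i) - dplus R i y * u (y + e i))) := by
    intro y _
    have hk : ∑ k, (gHalf (x + e j - y) - gHalf (x - y)) * (cutoff R y * (g k (y + v k) - g k y)) =
        (gHalf (x + e j - y) - gHalf (x - y)) * (cutoff R y * ∑ k, (g k (y + v k) - g k y)) := by
      rw [Finset.mul_sum, Finset.mul_sum]
    rw [hk, hΔw y]
    ring
  rw [Finset.sum_congr rfl hsplit, Finset.sum_add_distrib, Finset.sum_comm, Finset.sum_sub_distrib,
    sum_gHalf_mul_cutoffTerm_eq u (x + e j), sum_gHalf_mul_cutoffTerm_eq u x, ← Finset.sum_sub_distrib]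
  have hT : |∑ z ∈ sbox (d := d) (2 * R + 1), (u z * kernel₁ R (x + e j) z - u z * kernel₁ R x z)| ≤
      M₀ * (d * (4 * Kg * 2 ^ d * 7 ^ (d - 1) + 2 * Kh * 28 ^ d)) / R := by
    rw [Finset.sum_congr rfl fun z _ => (mul_sub (u z) _ _).symm]
    exact kernel_diff_sum_le hd hKg hKh hg hh hR x hxn j u fun z hz =>
      hu z fun k => by simpa using forall_abs_le_of_mem_sbox hR1 hz 0 (fun k => by simp) k
  have hS : ∀ k : Fin m, |∑ y ∈ sbox (d := d) (2 * R + 1), (gHalf (x + e j - y) - gHalf (x - y)) * (cutoff R y * (g k (y + v k) - g k y))| ≤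
      M * (Kh * 3 ^ d * (3 ^ d * ((1 + 2 * d * 3 ^ (d - 1)) * (2 + Real.log (2 * R + 1 : ℕ)))) + Kg * 2 ^ (d - 1) * 5 ^ d) := by
    intro k
    obtain ⟨i, hi⟩ := hv k
    refine abel_sum_le hd hKg hKh hg hh hR x hxn j i (v k) hi (cutoff R) (fun y => ?_) (fun y => ?_) (fun y hy => ?_)
      (g k) (fun y hy => hgM y (fun k' => by simpa using forall_abs_le_of_mem_sbox hR1 hy 0 (fun k => by simp) k') k)
      (fun y hy => ?_)
    · rw [abs_of_nonneg (cutoff_nonneg R y)]; exact cutoff_le_one R y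
    · rcases hi with h | h
      · rw [h, show cutoff R (y - e i) - cutoff R y = -dminus R i y by simp only [dminus]; ring, abs_neg]
        exact abs_dminus_le hR0 i y
      · rw [h, sub_neg_eq_add, show cutoff R (y + e i) - cutoff R y = dplus R i y by simp only [dplus]]
        exact abs_dplus_le hR0 i y
    · rcases hi with h | h
      · rw [h]
        have := dminus_eq_zero hR0 (i := i) (z := y) (by omega)
        simp only [dminus] at this; linarith
      · rw [h, sub_neg_eq_add]
        have h1 : |(y + e i) i| + 1 ≤ (R : ℤ) := by
          rw [add_e_apply_same]; have := abs_add_le (y i) (1 : ℤ); rw [abs_one] at this; omega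
        have := dminus_eq_zero hR0 h1
        simp only [dminus, add_sub_cancel_right] at this; linarith
    · -- off `sbox (2R)` the cut-off at `y − v` vanishes
      obtain ⟨k', hk'⟩ := not_mem_sbox.1 hy
      have hvk : |v k k'| ≤ 1 := abs_apply_le_one_of_unit hi k'
      have h2 : 2 * (R : ℤ) ≤ |(y - v k) k'| := by
        rw [Pi.sub_apply]
        have := abs_sub_abs_le_abs_sub (y k') (v k k')
        push_cast at hk'
        omega
      rw [cutoff_eq_zero h2, zero_mul]
  refine (abs_add_le _ _).trans (add_le_add ?_ hT)
  refine (Finset.abs_sum_le_sum_abs _ _).trans ?_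
  calc ∑ k : Fin m, |∑ y ∈ sbox (d := d) (2 * R + 1), (gHalf (x + e j - y) - gHalf (x - y)) * (cutoff R y * (g k (y + v k) - g k y))|
      ≤ ∑ _k : Fin m, M * (Kh * 3 ^ d * (3 ^ d * ((1 + 2 * d * 3 ^ (d - 1)) * (2 + Real.log (2 * R + 1 : ℕ)))) + Kg * 2 ^ (d - 1) * 5 ^ d) :=
        Finset.sum_le_sum fun k _ => hS k
    _ = m * M * (Kh * 3 ^ d * (3 ^ d * ((1 + 2 * d * 3 ^ (d - 1)) * (2 + Real.log (2 * R + 1 : ℕ)))) + Kg * 2 ^ (d - 1) * 5 ^ d) := by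
        rw [Finset.sum_const, Finset.card_univ, Fintype.card_fin, nsmul_eq_mul]; ring

/-- **INTERIOR LOG-LIPSCHITZ ESTIMATE FOR THE DIVERGENCE-FORM LATTICE POISSON EQUATION** (`d ≥ 3`): there is `C > 0` such that for every
`R ≥ 4`, every `u`, unit steps `v_k = ±e_{i_k}` and data `g_k` (`k < m`) with, on the sup-box `{|z_k| ≤ 4R}`, `|u| ≤ M₀`, `|g_k| ≤ M` and
`−Δu(z) = Σ_k (g_k(z + v_k) − g_k(z))`, and every direction `j`:
`|u(e_j) − u(0)| ≤ C(1 + log R)(m·M + M₀/R)` and `|u(−e_j) − u(0)| ≤ C(1 + log R)(m·M + M₀/R)`. [folklore] -/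
theorem divForm_sub_le (hd : 3 ≤ d) : ∃ C : ℝ, 0 < C ∧ ∀ (R : ℕ), 4 ≤ R →
    ∀ (m : ℕ) (u : Site d → ℝ) (g : Fin m → Site d → ℝ) (v : Fin m → Site d) (M₀ M : ℝ),
    (∀ k, ∃ i, v k = e i ∨ v k = -e i) →
    (∀ z : Site d, (∀ k, |z k| ≤ 4 * (R : ℤ)) → |u z| ≤ M₀) →
    (∀ z : Site d, (∀ k, |z k| ≤ 4 * (R : ℤ)) → ∀ k, |g k z| ≤ M) →
    (∀ z : Site d, (∀ k, |z k| ≤ 4 * (R : ℤ)) → -latticeLaplacianZd u z = ∑ k, (g k (z + v k) - g k z)) →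
    ∀ j : Fin d, |u (e j) - u 0| ≤ C * (1 + Real.log R) * (m * M + M₀ / R) ∧
      |u (-e j) - u 0| ≤ C * (1 + Real.log R) * (m * M + M₀ / R) := by
  obtain ⟨Kg, hKg, hg⟩ := exists_gHalf_grad_le (d := d) hd
  obtain ⟨Kh, hKh, hh⟩ := exists_gHalf_hess_le (d := d) hd
  set A₁ : ℝ := 4 * (Kh * 3 ^ d * (3 ^ d * (1 + 2 * d * 3 ^ (d - 1)))) + Kg * 2 ^ (d - 1) * 5 ^ d with hA₁
  set D₁ : ℝ := d * (4 * Kg * 2 ^ d * 7 ^ (d - 1) + 2 * Kh * 28 ^ d) with hD₁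
  have hA₁0 : 0 ≤ A₁ := by positivity
  have hD₁0 : 0 ≤ D₁ := by positivity
  refine ⟨A₁ + D₁ + 1, by positivity, fun R hR m u g v M₀ M hv hu hgM heq j => ?_⟩
  have hR0 : 0 < R := by omega
  have hRr : (0 : ℝ) < R := by exact_mod_cast hR0
  have hR1 : (1 : ℝ) ≤ R := by exact_mod_cast (show 1 ≤ R by omega)
  have hlog0 : 0 ≤ Real.log R := Real.log_nonneg hR1
  have hM0 : 0 ≤ M₀ := (abs_nonneg _).trans (hu 0 fun k => by simp only [Pi.zero_apply, abs_zero]; positivity)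
  -- `m·M ≥ 0` (vacuous when `m = 0`)
  have hmM : 0 ≤ (m : ℝ) * M := by
    rcases Nat.eq_zero_or_pos m with hm | hm
    · rw [hm, Nat.cast_zero, zero_mul]
    · have : 0 ≤ M := (abs_nonneg _).trans (hgM 0 (fun k => by simp only [Pi.zero_apply, abs_zero]; positivity) ⟨0, hm⟩)
      positivity
  -- `2 + log(2R+1) ≤ 4(1 + log R)`
  have hlogR : 2 + Real.log (2 * R + 1 : ℕ) ≤ 4 * (1 + Real.log R) := by
    have h3 : Real.log (2 * R + 1 : ℕ) ≤ Real.log 3 + Real.log R := by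
      rw [← Real.log_mul (by norm_num) hRr.ne']
      exact Real.log_le_log (by positivity) (by push_cast; linarith)
    have h4 : Real.log 3 ≤ 2 := by have := Real.log_le_sub_one_of_pos (show (0:ℝ) < 3 by norm_num); linarith
    linarith
  -- the explicit estimate at the base points `0` and `−e_j`
  have key : ∀ x : Site d, (∀ k, |x k| ≤ 1) → (∀ k, |(x + e j) k| ≤ 1) →
      |u (x + e j) - u x| ≤ (A₁ + D₁ + 1) * (1 + Real.log R) * (m * M + M₀ / R) := by
    intro x hx hxj
    have h := divForm_sub_le_at hd hKg hKh hg hh hR u g v hv hu hgM heq x j hx hxj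
    have hA : Kh * 3 ^ d * (3 ^ d * ((1 + 2 * d * 3 ^ (d - 1)) * (2 + Real.log (2 * R + 1 : ℕ)))) + Kg * 2 ^ (d - 1) * 5 ^ d ≤
        A₁ * (1 + Real.log R) := by
      rw [hA₁]
      have h1 : Kh * 3 ^ d * (3 ^ d * ((1 + 2 * d * 3 ^ (d - 1)) * (2 + Real.log (2 * R + 1 : ℕ)))) ≤
          Kh * 3 ^ d * (3 ^ d * ((1 + 2 * d * 3 ^ (d - 1)) * (4 * (1 + Real.log R)))) := by gcongr
      have h2 : Kg * 2 ^ (d - 1) * 5 ^ d ≤ Kg * 2 ^ (d - 1) * 5 ^ d * (1 + Real.log R) :=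
        le_mul_of_one_le_right (by positivity) (by linarith)
      nlinarith [h1, h2]
    have hB : M₀ * D₁ / R ≤ D₁ * (1 + Real.log R) * (M₀ / R) := by
      rw [show M₀ * D₁ / R = D₁ * 1 * (M₀ / R) by ring]
      exact mul_le_mul_of_nonneg_right (mul_le_mul_of_nonneg_left (by linarith) hD₁0) (by positivity)
    calc |u (x + e j) - u x| ≤ m * M * (A₁ * (1 + Real.log R)) + D₁ * (1 + Real.log R) * (M₀ / R) :=
          h.trans (add_le_add (mul_le_mul_of_nonneg_left hA hmM) (by rw [← hD₁]; exact hB))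
      _ = (1 + Real.log R) * (A₁ * (m * M) + D₁ * (M₀ / R)) := by ring
      _ ≤ (1 + Real.log R) * ((A₁ + D₁ + 1) * (m * M) + (A₁ + D₁ + 1) * (M₀ / R)) := by
          refine mul_le_mul_of_nonneg_left (add_le_add ?_ ?_) (by linarith)
          · exact mul_le_mul_of_nonneg_right (by linarith) hmM
          · exact mul_le_mul_of_nonneg_right (by linarith) (by positivity)
      _ = (A₁ + D₁ + 1) * (1 + Real.log R) * (m * M + M₀ / R) := by ring
  have habs1 : ∀ k : Fin d, |(e j : Site d) k| ≤ 1 := fun k => by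
    by_cases hk : k = j
    · subst hk; simp
    · simp [hk]
  constructor
  · have h := key 0 (fun k => by simp) (fun k => by rw [zero_add]; exact habs1 k)
    rwa [zero_add] at h
  · have h := key (-e j) (fun k => by rw [Pi.neg_apply, abs_neg]; exact habs1 k)
      (fun k => by simp only [neg_add_cancel, Pi.zero_apply, abs_zero]; exact zero_le_one)
    rw [neg_add_cancel] at h
    rwa [abs_sub_comm]

/-- **THE SAME ESTIMATE with the equation read as `Σᵢ ((u z − u(z+eᵢ)) + (u z − u(z−eᵢ))) = Σ_k (g_k(z+v_k) − g_k z)`** — the componentwise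
form of the tree's `LatticeChain.negLap₂` (`−Δ = Σᵢ (2u − u(·+eᵢ) − u(·−eᵢ))`). [folklore] -/
theorem divForm_sub_le' (hd : 3 ≤ d) : ∃ C : ℝ, 0 < C ∧ ∀ (R : ℕ), 4 ≤ R →
    ∀ (m : ℕ) (u : Site d → ℝ) (g : Fin m → Site d → ℝ) (v : Fin m → Site d) (M₀ M : ℝ),
    (∀ k, ∃ i, v k = e i ∨ v k = -e i) →
    (∀ z : Site d, (∀ k, |z k| ≤ 4 * (R : ℤ)) → |u z| ≤ M₀) →
    (∀ z : Site d, (∀ k, |z k| ≤ 4 * (R : ℤ)) → ∀ k, |g k z| ≤ M) →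
    (∀ z : Site d, (∀ k, |z k| ≤ 4 * (R : ℤ)) → ∑ i, ((u z - u (z + e i)) + (u z - u (z - e i))) = ∑ k, (g k (z + v k) - g k z)) →
    ∀ j : Fin d, |u (e j) - u 0| ≤ C * (1 + Real.log R) * (m * M + M₀ / R) ∧
      |u (-e j) - u 0| ≤ C * (1 + Real.log R) * (m * M + M₀ / R) := by
  obtain ⟨C, hC, h⟩ := divForm_sub_le (d := d) hd
  refine ⟨C, hC, fun R hR m u g v M₀ M hv hu hgM heq j => h R hR m u g v M₀ M hv hu hgM (fun z hz => ?_) j⟩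
  rw [← heq z hz, latticeLaplacianZd_eq_sum_sub, ← Finset.sum_neg_distrib]
  refine Finset.sum_congr rfl fun i _ => ?_
  simp only [← e_def]; ring

end Summit.QuantumFields.YangMills.Theorems.CurvGradFlat

end
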